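import Summits.QuantumFields.YangMills.Theorems.BalabanUVNodesN15NeumannCubeTailRowDefect
import Summits.QuantumFields.YangMills.Theorems.BalabanUVNodesN15NeumannCubeDivergenceDefect
import HarnessLib

/-!
# THE ADJOINT TAIL OF THE NEUMANN IMAGES CUBE: the flat cube's TRUE RIGHT-LOCALITY DEFECT on the partition — `M_χ̃∘G(□)∘Δ_a∘M_h − M_h = −M_χ̃∘(χ_□∘Sym∘(G∘M_{1−χ_□}N_LM_h)∘χ_□)`
# EXACTLY (the nonlocal part `N_L = aQ*Q − ∂Π∂*` leaks out of the cube), its row EXPONENTIALLY SMALL IN THE MARGIN, and its two-spacing η-defect from torus letters — the mirror image of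
# dag-n15-a's N-IIt ∕ N-IIu tail rows (dag-n15-c g19, FILE 170; N15 = NE2, s1 road (c) — the producer of FILES 167–169's displayed defects `Ẽ_k` at the cover)

Cell `pub-ymgap`, seat `pub-ymgap-dag-n15-c` (R134 (a); HUMAN RULING D-0062), generation 19.  `bears_on: R4∕N15 · K3⁸ SpineGivenEndpointR13SepCoPHV (stmt-QuantumFields-27366)`.
Filed `--kind proof --supports stmt-QuantumFields-27366 --as helper` — COUNT-NEUTRAL.  Theorems only; 0 `def`, 0 `sorry`.  Imports BY NAME dag-n15-a `…NeumannCubeTailRowDefect`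
(`hasMaj_tailSandwich`, `hasMaj_idef_tailSandwich`, `hasMaj_nonlocalPart`, `deltaOp_eq_lapOp_zero_add`, `hasMaj_chiCube_symOp_comp`, `hasMaj_comp_mulOp_chiCube`, `mulOp_chi_symOp_mulOp_chi`,
`neumannCubeG_eq_chiCube`, `chiCube_kingPrV`, `gOp_comp_deltaOp`, `hasMaj_pull_comp₂`, `hasMaj_mulOp_comp_of_abs_le_one`) and `…NeumannCubeDivergenceDefect` (`hasMaj_idef_chiCube_symOp_sandwich_of`,
`sD_one`).  Nothing in the tree is modified; nothing restated.

WHY (g19 FINDING (i)).  The node's entry 2 `cvGlued∘∇^{U*}` needs the ADJOINT gluing (FILES 147–169); identifying the adjoint glued operator with `cvGlued` requires the per-cube right locality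
`X_k∘Δ∘M_{h_k} = M_{h_k} + Ẽ_k` with the TRUE defect (FILE 167 ★★), and by FILE 148 `projO_dressedV_comp_lap_mulOp` `Ẽ_k = Ñ_{𝒲_k}∘F^flat_k` where `F^flat_k = M_χ̃N_kΔ₀M_{h_k} − M_{h_k}` is
the FLAT cube's right-locality defect.  For the Neumann images cube `N = Sym∘G∘M_{χ_□}` (N-IIb `neumannCubeG_eq_chiCube`) and `Δ₀ = Σ∇*∇ + N_L` (`deltaOp_eq_lapOp_zero_add`):
`N∘Δ₀∘M_h = Sym∘G∘Δ₀∘M_h − Sym∘G∘M_{1−χ_□}∘Δ₀∘M_h = Sym∘M_h − Sym∘G∘M_{1−χ_□}∘N_L∘M_h` (`GΔ₀ = 1`; the local part cannot leave the cube from `supp h`), and `M_χ̃∘Sym∘M_h = M_h`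
(`χ°Symχ° = χ°`: only the identity image survives inside).  So `F^flat = −M_χ̃∘Sym∘G∘M_{1−χ_□}N_LM_h`: the nonlocal part from `supp h` to OUTSIDE the cube, propagated back and folded by the
images — the transpose of dag-n15-a's tail `−M_hN_LM_{1−χ̃}∘G(□)`; exponentially small in the margin, and with a genuine η-RATE across King's pairing (block-aligned cut `χ_□`: zero fit).

WHAT.  §1 `mulOp_comp_lapOp_zero_comp_mulOp_eq_zero` (stencil separation), `mulOp_comp_symOp_comp_mulOp_of_intBonds` (`M_χ̃SymM_h = M_h`), ★★ `bump_neumannCubeG_deltaOp_mulOp_eq` (the identity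
above, in the form `M_h − M_χ̃∘(χ_□∘Sym∘(G∘M_{1−χ_□}N_LM_h∘M_{χ_□}))`... written `M_χ̃∘(M_{χ_□}∘Sym∘(G∘(M_{1−χ_□}∘N_L∘M_h))∘M_{χ_□})`); §2 ★★ `hasMaj_adjTail_neumannCubeG` (one grid, any spacing:
`≤ 1_□1_□·2^{d+1}e^{ρ}·C·c_Ne^{−(δ_N−ρ₁)gap}·c_r·e^{−ρd}`); §3 ★★★ `hasMaj_idef_adjTail_neumannCubeG_of` (two grids along King's pairing, from the torus letters `G`, `𝔇(G′, G)`, `∇G`, `∂Π∂*`,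
`𝔇(N′_L, N_L)` and the partition's ∕ bump's fits; rate `ρ`, every summand carrying either a two-grid letter, a fit, or `1∕L^k`).

HONEST FRAMING ∕ LIMITS.  Block-majorant bookkeeping and finite operator algebra over LANDED theorems on dag-n15-a's model carriers (doubled torus, images cubes); nothing of [B5]∕[B6]∕[B9]
asserted ((2.36)–(2.38) p.229, (2.91)–(2.93) p.239, (2.133)–(2.134) p.247 = SHAPES ∕ MECHANISM; Thm 3.14 pp.426–427 = difference TEMPLATE).  NE2 for non-abelian `G(U)` NOT proved
(C-N15-1); N15 booked «discharged AS CONSUMED at the U-blind v7 pin» (№253) — road (c)'s bookkeeping, NO count; one finite 𝕋⁴ at fixed ε — NOT infinite volume, NOT OS, NOT a mass gap,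
NOT Clay.  Restate-immune (no Theses import).
-/

noncomputable section

open scoped BigOperators
open Finset

namespace Summit.QuantumFields.YangMills.BalabanUVNodes.N15.TwoGrid

open Literature.MathematicalPhysics.QuantumFieldTheory.Balaban1983to89
open Literature.MathematicalPhysics.QuantumFieldTheory.Balaban1983to89.B5Prop11Plancherel (Tor fine)
open Literature.MathematicalPhysics.QuantumFieldTheory.Balaban1983to89.B6Prop26Gluing (mulOp mulOp_apply ind ind_nonneg ind_le_one)
open Literature.MathematicalPhysics.QuantumFieldTheory.King1986.Torus (blockOf tdistT tdistT_nonneg)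
open Literature.MathematicalPhysics.QuantumFieldTheory.Balaban1983to89.B11SectG (BlockNorm HasMaj RowSum hasMaj_comp_exp)
open Literature.MathematicalPhysics.QuantumFieldTheory.Balaban1983to89.B6UnitTorusCarrier (unitTorusGeo triangle254_unitTorusGeo rowSum_unitTorusGeo)
open Literature.MathematicalPhysics.QuantumFieldTheory.Balaban1983to89.B6RandomWalk (Triangle254)
open Literature.MathematicalPhysics.QuantumFieldTheory.Balaban1983to89.T4EtaRateDefect (idef idef_apply idef_comp)
open Literature.MathematicalPhysics.QuantumFieldTheory.Balaban1983to89.T4EtaRateCoeffDefect (pull pull_apply diagK diagK_nonneg hasMaj_mulOp idef_mulOp_eq)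
open Summit.QuantumFields.YangMills.BalabanUVNodes.N15.VectorPiece (blkFine kingPrV blkFine_comp_kingPrV bshiftEquiv)
open Summit.QuantumFields.YangMills.BalabanUVNodes.N15.Gluing (lapOp lapDir hasMaj_diag_comp hasMaj_comp_diag hasMaj_nonlocalPart deltaOp_eq_lapOp_zero_add)
open Summit.QuantumFields.YangMills.BalabanUVNodes.N15.BackgroundLayer (fgrad bgrad fgradAdj fgrad_apply bgrad_apply fgradAdj_apply)

variable {d : ℕ}

/-! ## §1 Algebra: the flat cube's right-locality defect on the partition, exactly -/

section Algebra

variable {X J : Type} [Fintype J] (n : ℝ) (e : J → X ≃ X)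

omit [Fintype J] in
/-- `M_a∘∇*∇∘M_k = 0` when `a·k = a·(k∘e) = a·(k∘e⁻¹) = 0` (the second difference's stencil). [folklore; cite: Balaban1984PropagatorsII, (2.38) p.229 (mechanism)] -/
theorem mulOp_comp_lapDir_comp_mulOp_eq_zero_of_stencil (ε : X ≃ X) {a k : X → ℝ} (h0 : ∀ p, a p * k p = 0) (h1 : ∀ p, a p * k (ε p) = 0) (h2 : ∀ p, a p * k (ε.symm p) = 0) :
    mulOp a ∘ₗ lapDir n ε ∘ₗ mulOp k = 0 := by
  refine LinearMap.ext fun f => funext fun p => ?_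
  simp only [lapDir, LinearMap.comp_apply, mulOp_apply, fgradAdj_apply, fgrad_apply, Equiv.apply_symm_apply, LinearMap.zero_apply, Pi.zero_apply]
  have key : a p * (n * (n * (k p * f p - k (ε.symm p) * f (ε.symm p)) - n * (k (ε p) * f (ε p) - k p * f p))) =
      n * n * (2 * (a p * k p) * f p - a p * k (ε.symm p) * f (ε.symm p) - a p * k (ε p) * f (ε p)) := by ring
  rw [key, h0 p, h1 p, h2 p]
  ring

/-- **STENCIL SEPARATION FOR `Σ_μ∇*_μ∇_μ`**: `M_a∘(Σ_μ∇*_μ∇_μ + 0)∘M_k = 0` when `a` vanishes on `supp k` and on its one-step neighbours in every direction. [cite: Balaban1984PropagatorsII, (2.38) p.229 (mechanism)] -/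
theorem mulOp_comp_lapOp_zero_comp_mulOp_eq_zero {a k : X → ℝ} (h0 : ∀ p, a p * k p = 0) (h1 : ∀ μ p, a p * k (e μ p) = 0) (h2 : ∀ μ p, a p * k ((e μ).symm p) = 0) :
    mulOp a ∘ₗ lapOp n e 0 ∘ₗ mulOp k = 0 := by
  have hl : ∀ μ, mulOp a ∘ₗ lapDir n (e μ) ∘ₗ mulOp k = 0 := fun μ => mulOp_comp_lapDir_comp_mulOp_eq_zero_of_stencil n (e μ) h0 (h1 μ) (h2 μ)
  refine LinearMap.ext fun f => ?_
  have hf : ∀ μ, mulOp a (lapDir n (e μ) (mulOp k f)) = 0 := fun μ => by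
    have := LinearMap.congr_fun (hl μ) f; simpa only [LinearMap.comp_apply, LinearMap.zero_apply] using this
  simp only [lapOp, LinearMap.comp_apply, LinearMap.coe_sum, Finset.sum_apply, map_sum, LinearMap.zero_apply, hf, Finset.sum_const_zero, add_zero]

end Algebra

section Cube

variable {L : ℕ} {M : Fin (d + 1) → ℕ} [∀ μ, NeZero (M μ)] {k n : ℕ} [NeZero n] {c : Tor M} {S : ℕ}

/-- **ONLY THE IDENTITY IMAGE SURVIVES INSIDE**: `M_χ̃∘Sym∘M_h = M_h` for a bump `χ̃` and a partition function `h` both living on interior bonds, `χ̃ = 1` on `supp h` (N-IIIa `χ°Symχ° = χ°`).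
[cite: Balaban1984PropagatorsII, (2.37) p.229 (method of images)] -/
theorem mulOp_comp_symOp_comp_mulOp_of_intBonds (hM : ∀ ν, M ν = 2 * S) {χt h : Tor (fine n M) × Fin (d + 1) → ℝ} (hχt : ∀ b, χt b ≠ 0 → b ∈ intBonds M n c S)
    (hh : ∀ b, h b ≠ 0 → b ∈ intBonds M n c S) (hth : ∀ b, h b ≠ 0 → χt b = 1) :
    mulOp χt ∘ₗ symOp M n c ∘ₗ mulOp h = mulOp h := by
  have h1 : mulOp χt = mulOp χt ∘ₗ mulOp (chiInt M n c S) := (Gluing.mulOp_comp_mulOp_of_support fun b hb => chiInt_of_intBond (hχt b hb)).symm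
  have h2 : mulOp h = mulOp (chiInt M n c S) ∘ₗ mulOp h := by
    rw [Gluing.mulOp_comp_mulOp_comm]; exact (Gluing.mulOp_comp_mulOp_of_support fun b hb => chiInt_of_intBond (hh b hb)).symm
  have h3 : mulOp χt ∘ₗ mulOp h = mulOp h := by
    rw [Gluing.mulOp_comp_mulOp_comm]; exact Gluing.mulOp_comp_mulOp_of_support hth
  calc mulOp χt ∘ₗ symOp M n c ∘ₗ mulOp h = (mulOp χt ∘ₗ mulOp (chiInt M n c S)) ∘ₗ symOp M n c ∘ₗ (mulOp (chiInt M n c S) ∘ₗ mulOp h) := by rw [← h1, ← h2]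
    _ = mulOp χt ∘ₗ (mulOp (chiInt M n c S) ∘ₗ symOp M n c ∘ₗ mulOp (chiInt M n c S)) ∘ₗ mulOp h := by simp only [LinearMap.comp_assoc]
    _ = mulOp h := by rw [mulOp_chi_symOp_mulOp_chi M n c S hM, ← LinearMap.comp_assoc, ← h1, h3]

omit [∀ μ, NeZero (M μ)] [NeZero n] in
/-- `mulOp (1 − χ) = 1 − mulOp χ`. [folklore] -/
theorem mulOp_one_sub (χ : Tor (fine n M) × Fin (d + 1) → ℝ) : mulOp (1 - χ) = LinearMap.id - mulOp χ := by
  refine LinearMap.ext fun f => funext fun b => ?_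
  simp only [mulOp_apply, Pi.sub_apply, Pi.one_apply, LinearMap.sub_apply, LinearMap.id_apply, sub_mul, one_mul]

/-- ★★ **THE FLAT IMAGES CUBE's RIGHT-LOCALITY DEFECT ON THE PARTITION, EXACTLY** (doubled-cube torus `M_ν = 2S`, any spacing): for a bump `χ̃` and a partition function `h` on interior bonds with
`χ̃ = 1` on `supp h`, `χ̃` inside the cube's blocks, and `supp h` with its one-step neighbours inside the cube's blocks:
`M_χ̃∘G(□ + c)∘(Σ∇*∇ + N_L)∘M_h = M_h − M_χ̃∘(M_{χ_□}∘Sym∘(G∘(M_{1−χ_□}∘N_L∘M_h))∘M_{χ_□})`, `N_L = aQ*Q − ∂Π∂*` — the nonlocal part leaks out of the cube and is folded back by the images.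
[cite: Balaban1984PropagatorsII, (2.36)–(2.38) p.229 (images cubes), (2.91)–(2.93) p.239 (the adjoint parametrix identity: mechanism); Balaban1984PropagatorsI, (1.69) p.29, (1.120)–(1.123) p.37 (the nonlocal part: shape)] -/
theorem bump_neumannCubeG_deltaOp_mulOp_eq (hM : ∀ ν, M ν = 2 * S) {a : ℝ} (ha : 0 < a) {χt h : Tor (fine n M) × Fin (d + 1) → ℝ}
    (hχt : ∀ b, χt b ≠ 0 → b ∈ intBonds M n c S) (hh : ∀ b, h b ≠ 0 → b ∈ intBonds M n c S) (hth : ∀ b, h b ≠ 0 → χt b = 1)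
    (hχtc : ∀ b, χt b ≠ 0 → chiCube M n c S b = 1) (hhc : ∀ b, h b ≠ 0 → chiCube M n c S b = 1)
    (hhc1 : ∀ μ b, h b ≠ 0 → chiCube M n c S ((bshiftEquiv M n μ).symm b) = 1) (hhc2 : ∀ μ b, h b ≠ 0 → chiCube M n c S (bshiftEquiv M n μ b) = 1) :
    mulOp χt ∘ₗ neumannCubeG M n c S a ∘ₗ (lapOp (n : ℝ) (bshiftEquiv M n) 0 + (a • (qvAdjRe M n ∘ₗ qvRe M n) + (-landauRe M n))) ∘ₗ mulOp h =
      mulOp h - mulOp χt ∘ₗ (mulOp (chiCube M n c S) ∘ₗ symOp M n c ∘ₗ (gOp M n a ∘ₗ (mulOp (1 - chiCube M n c S) ∘ₗ (a • (qvAdjRe M n ∘ₗ qvRe M n) + (-landauRe M n)) ∘ₗ mulOp h)) ∘ₗ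
        mulOp (chiCube M n c S)) := by
  have hn : 1 ≤ n := Nat.one_le_iff_ne_zero.mpr (NeZero.ne n)
  -- the local part cannot leave the cube from `supp h`
  have hloc : mulOp (1 - chiCube M n c S) ∘ₗ lapOp (n : ℝ) (bshiftEquiv M n) 0 ∘ₗ mulOp h = 0 := by
    refine mulOp_comp_lapOp_zero_comp_mulOp_eq_zero (n : ℝ) (bshiftEquiv M n) (fun b => ?_) (fun μ b => ?_) (fun μ b => ?_)
    · by_cases hb : h b = 0
      · rw [hb, mul_zero]
      · rw [Pi.sub_apply, Pi.one_apply, hhc b hb, sub_self, zero_mul]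
    · by_cases hb : h (bshiftEquiv M n μ b) = 0
      · rw [hb, mul_zero]
      · have := hhc1 μ _ hb
        rw [Equiv.symm_apply_apply] at this
        rw [Pi.sub_apply, Pi.one_apply, this, sub_self, zero_mul]
    · by_cases hb : h ((bshiftEquiv M n μ).symm b) = 0
      · rw [hb, mul_zero]
      · have := hhc2 μ _ hb
        rw [Equiv.apply_symm_apply] at this
        rw [Pi.sub_apply, Pi.one_apply, this, sub_self, zero_mul]
  -- cuts: the bump and the partition live inside the cube's blocks
  have hχtc' : mulOp χt = mulOp χt ∘ₗ mulOp (chiCube M n c S) := (Gluing.mulOp_comp_mulOp_of_support hχtc).symm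
  have hhc' : mulOp h = mulOp h ∘ₗ mulOp (chiCube M n c S) := (Gluing.mulOp_comp_mulOp_of_support hhc).symm
  -- `M_{χ_□}Δ₀M_h = Δ₀M_h − M_{1−χ_□}N_LM_h`
  have hsplit : mulOp (chiCube M n c S) ∘ₗ (lapOp (n : ℝ) (bshiftEquiv M n) 0 + (a • (qvAdjRe M n ∘ₗ qvRe M n) + (-landauRe M n))) ∘ₗ mulOp h =
      deltaOp M n a ∘ₗ mulOp h - mulOp (1 - chiCube M n c S) ∘ₗ (a • (qvAdjRe M n ∘ₗ qvRe M n) + (-landauRe M n)) ∘ₗ mulOp h := by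
    have e1 : mulOp (chiCube M n c S) = LinearMap.id - mulOp (1 - chiCube M n c S) := by rw [mulOp_one_sub, sub_sub_cancel]
    rw [deltaOp_eq_lapOp_zero_add M n a, e1]
    simp only [LinearMap.sub_comp, LinearMap.id_comp, LinearMap.add_comp, LinearMap.comp_add, hloc, sub_zero]
    abel
  -- `Sym∘G∘Δ₀∘M_h = Sym∘M_h`
  have hSG : symOp M n c ∘ₗ gOp M n a ∘ₗ (deltaOp M n a ∘ₗ mulOp h) = symOp M n c ∘ₗ mulOp h := by
    rw [← LinearMap.comp_assoc (mulOp h) (deltaOp M n a) (gOp M n a), gOp_comp_deltaOp M n a hn ha, LinearMap.id_comp]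
  have hSh : mulOp χt ∘ₗ symOp M n c ∘ₗ mulOp h = mulOp h := mulOp_comp_symOp_comp_mulOp_of_intBonds hM hχt hh hth
  rw [neumannCubeG_eq_chiCube M n c S a hM hn ha]
  calc mulOp χt ∘ₗ (symOp M n c ∘ₗ gOp M n a ∘ₗ mulOp (chiCube M n c S)) ∘ₗ (lapOp (n : ℝ) (bshiftEquiv M n) 0 + (a • (qvAdjRe M n ∘ₗ qvRe M n) + (-landauRe M n))) ∘ₗ mulOp h
      = mulOp χt ∘ₗ symOp M n c ∘ₗ gOp M n a ∘ₗ (mulOp (chiCube M n c S) ∘ₗ (lapOp (n : ℝ) (bshiftEquiv M n) 0 + (a • (qvAdjRe M n ∘ₗ qvRe M n) + (-landauRe M n))) ∘ₗ mulOp h) := by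
        simp only [LinearMap.comp_assoc]
    _ = mulOp χt ∘ₗ symOp M n c ∘ₗ gOp M n a ∘ₗ (deltaOp M n a ∘ₗ mulOp h) -
          mulOp χt ∘ₗ symOp M n c ∘ₗ gOp M n a ∘ₗ (mulOp (1 - chiCube M n c S) ∘ₗ (a • (qvAdjRe M n ∘ₗ qvRe M n) + (-landauRe M n)) ∘ₗ mulOp h) := by
        rw [hsplit]; simp only [LinearMap.comp_sub]
    _ = mulOp h - mulOp χt ∘ₗ symOp M n c ∘ₗ gOp M n a ∘ₗ (mulOp (1 - chiCube M n c S) ∘ₗ (a • (qvAdjRe M n ∘ₗ qvRe M n) + (-landauRe M n)) ∘ₗ mulOp h) := by rw [hSG, hSh]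
    _ = mulOp h - mulOp χt ∘ₗ (mulOp (chiCube M n c S) ∘ₗ symOp M n c ∘ₗ (gOp M n a ∘ₗ (mulOp (1 - chiCube M n c S) ∘ₗ (a • (qvAdjRe M n ∘ₗ qvRe M n) + (-landauRe M n)) ∘ₗ mulOp h)) ∘ₗ
          mulOp (chiCube M n c S)) := by
        conv_lhs => enter [2]; rw [hχtc', hhc']
        simp only [LinearMap.comp_assoc]

/-! ## §2 The adjoint tail's row, one grid (any spacing) -/

/-- ★★ **THE ADJOINT TAIL ROW IS EXPONENTIALLY SMALL IN THE MARGIN**: from the torus letters `G ≤ Ce^{−δ₀d}`, `∂Π∂* ≤ C₁e^{−δ₁d}`, a row sum `c_r` at rate `σ`, `0 ≤ ρ ≤ ρ₁ ≤ δ_N ≤ δ₁`,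
`ρ + σ ≤ δ₀`, a bump `|χ̃| ≤ 1`, a partition function `|h| ≤ 1` on blocks `H ⊆ □` and `|y − y′|_T ≥ gap` for `y ∉ □`, `y′ ∈ H`:
`M_χ̃∘(M_{χ_□}∘Sym∘(G∘(M_{1−χ_□}∘N_L∘M_h))∘M_{χ_□}) ≤ 1_□(y)1_□(y′)·2^{d+1}·(1·C·c_Ne^{−(δ_N−ρ₁)gap}·c_r)e^{ρ}·e^{−ρ|y−y′|_T}`, `c_N = |a|e^{2δ_N} + C₁`.
[cite: Balaban1984PropagatorsII, (2.36)–(2.37) p.229 (images), Lemma 2.1 (2.61)–(2.62) p.234, (2.92)–(2.93) p.239, (2.133)–(2.134) p.247 (shapes); Balaban1984PropagatorsI, (1.69) p.29, Prop. 1.2 (1.110) p.35, (1.120)–(1.123) p.37, (1.126) p.38] -/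
theorem hasMaj_adjTail_neumannCubeG (hM : ∀ ν, M ν = 2 * S) {a C δ₀ C₁ δ₁ δN ρ₁ ρ σ cr gap : ℝ}
    (htri : Triangle254 (unitTorusGeo L k M)) (hrow : RowSum (unitTorusGeo L k M) σ cr) (hC : 0 ≤ C) (hC₁ : 0 ≤ C₁) (hδN : 0 ≤ δN) (hδN₁ : δN ≤ δ₁)
    (hρ₁ : ρ₁ ≤ δN) (hρ : 0 ≤ ρ) (hρρ₁ : ρ ≤ ρ₁) (hρσ : ρ + σ ≤ δ₀)
    (hG : HasMaj (BlockNorm.ofBlocks (unitTorusGeo L k M) (fun b : Tor (fine n M) × Fin (d + 1) => blockOf n M b.1))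
      (BlockNorm.ofBlocks (unitTorusGeo L k M) (fun b : Tor (fine n M) × Fin (d + 1) => blockOf n M b.1)) (gOp M n a) (fun y y' => C * Real.exp (-(δ₀ * tdistT M y y'))))
    (hNL : HasMaj (BlockNorm.ofBlocks (unitTorusGeo L k M) (fun b : Tor (fine n M) × Fin (d + 1) => blockOf n M b.1))
      (BlockNorm.ofBlocks (unitTorusGeo L k M) (fun b : Tor (fine n M) × Fin (d + 1) => blockOf n M b.1)) (landauRe M n) (fun y y' => C₁ * Real.exp (-(δ₁ * tdistT M y y'))))
    {χt h : Tor (fine n M) × Fin (d + 1) → ℝ} {H : Set (Tor M)}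
    (hχt1 : ∀ x, |χt x| ≤ 1) (hh1 : ∀ x, |h x| ≤ 1) (hhH : ∀ x, blockOf n M x.1 ∉ H → h x = 0) (hgap : ∀ y y', y ∉ cubeBlocks M c S → y' ∈ H → gap ≤ tdistT M y y') :
    HasMaj (BlockNorm.ofBlocks (unitTorusGeo L k M) (fun b : Tor (fine n M) × Fin (d + 1) => blockOf n M b.1))
      (BlockNorm.ofBlocks (unitTorusGeo L k M) (fun b : Tor (fine n M) × Fin (d + 1) => blockOf n M b.1))
      (mulOp χt ∘ₗ (mulOp (chiCube M n c S) ∘ₗ symOp M n c ∘ₗ (gOp M n a ∘ₗ (mulOp (1 - chiCube M n c S) ∘ₗ (a • (qvAdjRe M n ∘ₗ qvRe M n) + (-landauRe M n)) ∘ₗ mulOp h)) ∘ₗ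
        mulOp (chiCube M n c S)))
      (fun y y' => ind (cubeBlocks M c S : Set (Tor M)) y * ind (cubeBlocks M c S : Set (Tor M)) y' *
        (2 ^ (d + 1) * ((1 : ℝ) * C * ((|a| * (Real.exp δN * Real.exp δN) + C₁) * Real.exp (-((δN - ρ₁) * gap))) * cr * Real.exp ρ) * Real.exp (-(ρ * tdistT M y y')))) := by
  have hcr : 0 ≤ cr := hrow.nonneg c
  have ha₁ : 0 ≤ (|a| * (Real.exp δN * Real.exp δN) + C₁) * Real.exp (-((δN - ρ₁) * gap)) := by positivity
  -- the far sandwich `M_{1−χ_□}N_LM_h` (N-IIt §2 with the weights' roles exchanged), output localization dropped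
  have hP : HasMaj (BlockNorm.ofBlocks (unitTorusGeo L k M) (fun b : Tor (fine n M) × Fin (d + 1) => blockOf n M b.1))
      (BlockNorm.ofBlocks (unitTorusGeo L k M) (fun b : Tor (fine n M) × Fin (d + 1) => blockOf n M b.1))
      (mulOp (1 - chiCube M n c S) ∘ₗ (a • (qvAdjRe M n ∘ₗ qvRe M n) + (-landauRe M n)) ∘ₗ mulOp h)
      (fun y y' => (|a| * (Real.exp δN * Real.exp δN) + C₁) * Real.exp (-((δN - ρ₁) * gap)) * Real.exp (-(ρ₁ * tdistT M y y'))) := by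
    refine (hasMaj_tailSandwich (L := L) (k := k) (a := a) (H := (cubeBlocks M c S : Set (Tor M))ᶜ) (A := Hᶜ) hC₁ hδN hδN₁ hρ₁ hNL
      (fun x => by rw [Pi.sub_apply, Pi.one_apply]; unfold chiCube; split_ifs <;> norm_num) (fun x hx => ?_) hh1 (fun x hx => hhH x (fun hH => hx hH)) (fun y y' hy hy' => hgap y y' hy (not_not.mp hy'))).mono fun y y' => ?_
    · have hx' : blockOf n M x.1 ∈ cubeBlocks M c S := by by_contra hc; exact hx hc
      show (1 - chiCube M n c S) x = 0
      rw [Pi.sub_apply, Pi.one_apply]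
      unfold chiCube
      rw [if_pos hx', sub_self]
    · have hX : 0 ≤ (|a| * (Real.exp δN * Real.exp δN) + C₁) * Real.exp (-((δN - ρ₁) * gap)) * Real.exp (-(ρ₁ * tdistT M y y')) := by positivity
      calc ind ((cubeBlocks M c S : Set (Tor M))ᶜ) y * ((|a| * (Real.exp δN * Real.exp δN) + C₁) * Real.exp (-((δN - ρ₁) * gap)) * Real.exp (-(ρ₁ * tdistT M y y')))
          ≤ 1 * ((|a| * (Real.exp δN * Real.exp δN) + C₁) * Real.exp (-((δN - ρ₁) * gap)) * Real.exp (-(ρ₁ * tdistT M y y'))) := mul_le_mul_of_nonneg_right (ind_le_one _ _) hX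
        _ = _ := one_mul _
  -- `G ∘ P` by the row sum, then the source cut, the images, the bump
  have hX := hasMaj_comp_exp (b₁ := BlockNorm.ofBlocks (unitTorusGeo L k M) (fun b : Tor (fine n M) × Fin (d + 1) => blockOf n M b.1)) htri (fun y y' => tdistT_nonneg M y y') hrow hC ha₁ hρ
    hρρ₁ hρσ hG hP
  have hκ : (BlockNorm.ofBlocks (unitTorusGeo L k M) (fun b : Tor (fine n M) × Fin (d + 1) => blockOf n M b.1)).κ = 1 := rfl
  rw [hκ] at hX
  have hXc := hasMaj_comp_mulOp_chiCube (c := c) (S := S) (fun y y' => by positivity) hX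
  have hXs := hasMaj_chiCube_symOp_comp (by positivity) hρ hM hXc
  refine (hasMaj_mulOp_comp_of_abs_le_one _ hχt1 (fun y y' => ?_) hXs).mono fun y y' => le_of_eq ?_
  · exact mul_nonneg (mul_nonneg (ind_nonneg _ _) (ind_nonneg _ _)) (by positivity)
  · ring

end Cube

/-! ## §3 The adjoint tail's two-spacing η-defect from torus letters (coarse `L^k`, fine `L^r·L^k`, King's pairing) -/

section Defect

variable {L : ℕ} [NeZero L] {M : Fin (d + 1) → ℕ} [∀ μ, NeZero (M μ)] {k r : ℕ} {c : Tor M} {S : ℕ}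

omit [NeZero L] in
/-- the far factor `M_{1−χ_□}N_LM_h` of the adjoint tail: plain row `c_Ne^{−(δ_N−ρ₁)gap}·e^{−ρ₁d}` (N-IIt `hasMaj_tailSandwich` with the two weights' roles exchanged), any spacing. [cite: Balaban1984PropagatorsI, (1.69) p.29, (1.120)–(1.123) p.37] -/
theorem hasMaj_adjFar {n : ℕ} [NeZero n] {a C₁ δ₁ δN ρ₁ gap : ℝ} (hC₁ : 0 ≤ C₁) (hδN : 0 ≤ δN) (hδN₁ : δN ≤ δ₁) (hρ₁ : ρ₁ ≤ δN)
    (hNL : HasMaj (BlockNorm.ofBlocks (unitTorusGeo L k M) (fun b : Tor (fine n M) × Fin (d + 1) => blockOf n M b.1))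
      (BlockNorm.ofBlocks (unitTorusGeo L k M) (fun b : Tor (fine n M) × Fin (d + 1) => blockOf n M b.1)) (landauRe M n) (fun y y' => C₁ * Real.exp (-(δ₁ * tdistT M y y'))))
    {h : Tor (fine n M) × Fin (d + 1) → ℝ} {H : Set (Tor M)} (hh1 : ∀ x, |h x| ≤ 1) (hhH : ∀ x, blockOf n M x.1 ∉ H → h x = 0)
    (hgap : ∀ y y', y ∉ cubeBlocks M c S → y' ∈ H → gap ≤ tdistT M y y') :
    HasMaj (BlockNorm.ofBlocks (unitTorusGeo L k M) (fun b : Tor (fine n M) × Fin (d + 1) => blockOf n M b.1))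
      (BlockNorm.ofBlocks (unitTorusGeo L k M) (fun b : Tor (fine n M) × Fin (d + 1) => blockOf n M b.1))
      (mulOp (1 - chiCube M n c S) ∘ₗ (a • (qvAdjRe M n ∘ₗ qvRe M n) + (-landauRe M n)) ∘ₗ mulOp h)
      (fun y y' => (|a| * (Real.exp δN * Real.exp δN) + C₁) * Real.exp (-((δN - ρ₁) * gap)) * Real.exp (-(ρ₁ * tdistT M y y'))) := by
  refine (hasMaj_tailSandwich (L := L) (k := k) (a := a) (H := (cubeBlocks M c S : Set (Tor M))ᶜ) (A := Hᶜ) hC₁ hδN hδN₁ hρ₁ hNL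
    (fun x => by rw [Pi.sub_apply, Pi.one_apply]; unfold chiCube; split_ifs <;> norm_num) (fun x hx => ?_) hh1 (fun x hx => hhH x (fun hH => hx hH))
    (fun y y' hy hy' => hgap y y' hy (not_not.mp hy'))).mono fun y y' => ?_
  · have hx' : blockOf n M x.1 ∈ cubeBlocks M c S := by by_contra hc; exact hx hc
    show (1 - chiCube M n c S) x = 0
    rw [Pi.sub_apply, Pi.one_apply]; unfold chiCube; rw [if_pos hx', sub_self]
  · have hX : 0 ≤ (|a| * (Real.exp δN * Real.exp δN) + C₁) * Real.exp (-((δN - ρ₁) * gap)) * Real.exp (-(ρ₁ * tdistT M y y')) := by positivity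
    calc ind ((cubeBlocks M c S : Set (Tor M))ᶜ) y * ((|a| * (Real.exp δN * Real.exp δN) + C₁) * Real.exp (-((δN - ρ₁) * gap)) * Real.exp (-(ρ₁ * tdistT M y y')))
        ≤ 1 * ((|a| * (Real.exp δN * Real.exp δN) + C₁) * Real.exp (-((δN - ρ₁) * gap)) * Real.exp (-(ρ₁ * tdistT M y y'))) := mul_le_mul_of_nonneg_right (ind_le_one _ _) hX
      _ = _ := one_mul _

/-- the far factor's η-defect: `𝔇(M_{1−χ′_□}N′_LM_{h′}, M_{1−χ_□}N_LM_h) ≤ (c_No_h + r_N + 0·c_N)e^{−(δ_N−ρ₁)gap}·e^{−ρ₁d}` (N-IIu `hasMaj_idef_tailSandwich` with the weights' roles exchanged; the block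
cut has NO fit across King's pairing, N-IIb `chiCube_kingPrV`). [cite: Balaban1985BackgroundPropagators, Thm 3.14 pp.426–427 (difference template); Balaban1984PropagatorsI, (1.69) p.29, (1.120)–(1.123) p.37] -/
theorem hasMaj_idef_adjFar {a C₁ δ₁ δN ρ₁ rN gap oh : ℝ} (hC₁ : 0 ≤ C₁) (hδN : 0 ≤ δN) (hδN₁ : δN ≤ δ₁) (hρ₁ : ρ₁ ≤ δN) (hrN : 0 ≤ rN) (hoh : 0 ≤ oh)
    (hNL : HasMaj (BlockNorm.ofBlocks (unitTorusGeo L k M) (fun b : Tor (fine (L ^ k) M) × Fin (d + 1) => blockOf (L ^ k) M b.1))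
      (BlockNorm.ofBlocks (unitTorusGeo L k M) (fun b : Tor (fine (L ^ k) M) × Fin (d + 1) => blockOf (L ^ k) M b.1)) (landauRe M (L ^ k))
      (fun y y' => C₁ * Real.exp (-(δ₁ * tdistT M y y'))))
    (hNL' : HasMaj (BlockNorm.ofBlocks (unitTorusGeo L k M) (fun b : Tor (fine (L ^ r * L ^ k) M) × Fin (d + 1) => blockOf (L ^ r * L ^ k) M b.1))
      (BlockNorm.ofBlocks (unitTorusGeo L k M) (fun b : Tor (fine (L ^ r * L ^ k) M) × Fin (d + 1) => blockOf (L ^ r * L ^ k) M b.1)) (landauRe M (L ^ r * L ^ k))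
      (fun y y' => C₁ * Real.exp (-(δ₁ * tdistT M y y'))))
    (hDN : HasMaj (BlockNorm.ofBlocks (unitTorusGeo L k M) (fun b : Tor (fine (L ^ k) M) × Fin (d + 1) => blockOf (L ^ k) M b.1))
      (BlockNorm.ofBlocks (unitTorusGeo L k M) (fun b : Tor (fine (L ^ r * L ^ k) M) × Fin (d + 1) => blockOf (L ^ r * L ^ k) M b.1))
      (idef (pull (kingPrV L k r M)) (pull (kingPrV L k r M)) (a • (qvAdjRe M (L ^ r * L ^ k) ∘ₗ qvRe M (L ^ r * L ^ k)) + (-landauRe M (L ^ r * L ^ k)))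
        (a • (qvAdjRe M (L ^ k) ∘ₗ qvRe M (L ^ k)) + (-landauRe M (L ^ k)))) (fun y y' => rN * Real.exp (-(δN * tdistT M y y'))))
    {h : Tor (fine (L ^ k) M) × Fin (d + 1) → ℝ} {h' : Tor (fine (L ^ r * L ^ k) M) × Fin (d + 1) → ℝ} {H : Set (Tor M)}
    (hh1 : ∀ x, |h x| ≤ 1) (hhH : ∀ x, blockOf (L ^ k) M x.1 ∉ H → h x = 0) (hhH' : ∀ x', blockOf (L ^ r * L ^ k) M x'.1 ∉ H → h' x' = 0)
    (hfh : ∀ x', |h' x' - h (kingPrV L k r M x')| ≤ oh) (hgap : ∀ y y', y ∉ cubeBlocks M c S → y' ∈ H → gap ≤ tdistT M y y') :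
    HasMaj (BlockNorm.ofBlocks (unitTorusGeo L k M) (fun b : Tor (fine (L ^ k) M) × Fin (d + 1) => blockOf (L ^ k) M b.1))
      (BlockNorm.ofBlocks (unitTorusGeo L k M) (fun b : Tor (fine (L ^ r * L ^ k) M) × Fin (d + 1) => blockOf (L ^ r * L ^ k) M b.1))
      (idef (pull (kingPrV L k r M)) (pull (kingPrV L k r M))
        (mulOp (1 - chiCube M (L ^ r * L ^ k) c S) ∘ₗ (a • (qvAdjRe M (L ^ r * L ^ k) ∘ₗ qvRe M (L ^ r * L ^ k)) + (-landauRe M (L ^ r * L ^ k))) ∘ₗ mulOp h')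
        (mulOp (1 - chiCube M (L ^ k) c S) ∘ₗ (a • (qvAdjRe M (L ^ k) ∘ₗ qvRe M (L ^ k)) + (-landauRe M (L ^ k))) ∘ₗ mulOp h))
      (fun y y' => ((|a| * (Real.exp δN * Real.exp δN) + C₁) * oh + rN + 0 * (|a| * (Real.exp δN * Real.exp δN) + C₁)) * Real.exp (-((δN - ρ₁) * gap)) *
        Real.exp (-(ρ₁ * tdistT M y y'))) := by
  have hz : ∀ (m : ℕ) [NeZero m] (x : Tor (fine m M) × Fin (d + 1)), blockOf m M x.1 ∉ (cubeBlocks M c S : Set (Tor M))ᶜ → (1 - chiCube M m c S) x = 0 := by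
    intro m _ x hx
    have hx' : blockOf m M x.1 ∈ cubeBlocks M c S := by by_contra hc; exact hx hc
    rw [Pi.sub_apply, Pi.one_apply]; unfold chiCube; rw [if_pos hx', sub_self]
  exact hasMaj_idef_tailSandwich (L := L) (k := k) (r := r) (a := a) (H := (cubeBlocks M c S : Set (Tor M))ᶜ) (A := Hᶜ) hC₁ hδN hδN₁ hρ₁ hrN (le_refl (0 : ℝ)) hoh hNL hNL' hDN
    (hz (L ^ k)) hh1 (fun x hx => hhH x (fun hH => hx hH)) (fun x' => by rw [Pi.sub_apply, Pi.one_apply]; unfold chiCube; split_ifs <;> norm_num) (hz (L ^ r * L ^ k))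
    (fun x' hx' => hhH' x' (fun hH => hx' hH)) (fun x' => by rw [Pi.sub_apply, Pi.sub_apply, Pi.one_apply, Pi.one_apply, chiCube_kingPrV, sub_self, abs_zero]) hfh
    (fun y y' hy hy' => hgap y y' hy (not_not.mp hy'))

/-- ★★★ **THE η-DEFECT OF THE ADJOINT TAIL** (FILES 167–169's `r_E` ingredient at the cover): on the doubled-cube torus `M_ν = 2S`, coarse `L^k`, fine `L^r·L^k`, King's pairing on both sides, from
the torus letters `G, G′ ≤ Ce^{−δ₀d}`, `𝔇(G′, G) ≤ C₀e^{−δ₀d}`, `∇_νG ≤ C_∇e^{−δ₀d}`, `∂Π∂*, ∂Π∂*′ ≤ C₁e^{−δ₁d}`, `𝔇(N′_L, N_L) ≤ r_Ne^{−δ_Nd}`, a row sum `c_r` at rate `σ` (`0 ≤ ρ ≤ ρ₁ ≤ δ_N ≤ δ₁`,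
`ρ + σ ≤ δ₀`), partition functions `|h| ≤ 1`, `h′` on blocks `H ⊆ □` with fit `o_h`, fine bump `|χ̃′| ≤ 1` with fit `o_χ`, and `|y − y′|_T ≥ gap` for `y ∉ □`, `y′ ∈ H`:
`𝔇(M_χ̃′(χ′Sym′X′χ′), M_χ̃(χSymXχ)) ≤ 1_□1_□·[2^{d+1}e^{ρ}(C₀^X + (d+1)C₁^X) + o_χ·2^{d+1}(C a₁c_r)e^{ρ}]·e^{−ρd}`, `X = G∘M_{1−χ_□}N_LM_h`, `a₁ = c_Ne^{−(δ_N−ρ₁)gap}`,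
`C₀^X = C(c_No_h + r_N + 0·c_N)e^{−(δ_N−ρ₁)gap}c_r + C₀a₁c_r`, `C₁^X = |1∕L^k|C_∇a₁c_r` — every summand carries a two-grid letter, a fit, or `1∕L^k` (N-IIk′ `hasMaj_idef_chiCube_symOp_sandwich_of`).
[cite: Balaban1985BackgroundPropagators, Thm 3.14 pp.426–427 (difference template); Balaban1984PropagatorsII, (2.36)–(2.37) p.229 (images), Lemma 2.1 (2.61)–(2.62) p.234, (2.92)–(2.93) p.239, (2.133)–(2.134) p.247 (shapes); Balaban1984PropagatorsI, (1.69) p.29, Prop. 1.2 (1.110) p.35, (1.120)–(1.123) p.37, (1.126) p.38; King1986, Prop. 3.9 (3.73) p.665 (η-rate shape)] -/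
theorem hasMaj_idef_adjTail_neumannCubeG_of (hM : ∀ ν, M ν = 2 * S) {a : ℝ} {C C₀ CD δ₀ C₁ δ₁ δN rN ρ₁ ρ σ cr gap oh oχ : ℝ}
    (htri : Triangle254 (unitTorusGeo L k M)) (hrow : RowSum (unitTorusGeo L k M) σ cr) (hC : 0 ≤ C) (hC₀ : 0 ≤ C₀) (hCD : 0 ≤ CD) (hC₁ : 0 ≤ C₁) (hδN : 0 ≤ δN)
    (hδN₁ : δN ≤ δ₁) (hrN : 0 ≤ rN) (hρ₁ : ρ₁ ≤ δN) (hρ : 0 ≤ ρ) (hρρ₁ : ρ ≤ ρ₁) (hρσ : ρ + σ ≤ δ₀) (hoh : 0 ≤ oh) (hoχ : 0 ≤ oχ)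
    (hG : HasMaj (BlockNorm.ofBlocks (unitTorusGeo L k M) (fun b : Tor (fine (L ^ k) M) × Fin (d + 1) => blockOf (L ^ k) M b.1))
      (BlockNorm.ofBlocks (unitTorusGeo L k M) (fun b : Tor (fine (L ^ k) M) × Fin (d + 1) => blockOf (L ^ k) M b.1)) (gOp M (L ^ k) a)
      (fun y y' => C * Real.exp (-(δ₀ * tdistT M y y'))))
    (hG' : HasMaj (BlockNorm.ofBlocks (unitTorusGeo L k M) (fun b : Tor (fine (L ^ r * L ^ k) M) × Fin (d + 1) => blockOf (L ^ r * L ^ k) M b.1))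
      (BlockNorm.ofBlocks (unitTorusGeo L k M) (fun b : Tor (fine (L ^ r * L ^ k) M) × Fin (d + 1) => blockOf (L ^ r * L ^ k) M b.1)) (gOp M (L ^ r * L ^ k) a)
      (fun y y' => C * Real.exp (-(δ₀ * tdistT M y y'))))
    (h0 : HasMaj (BlockNorm.ofBlocks (unitTorusGeo L k M) (fun b : Tor (fine (L ^ k) M) × Fin (d + 1) => blockOf (L ^ k) M b.1))
      (BlockNorm.ofBlocks (unitTorusGeo L k M) (fun b' : Tor (fine (L ^ r * L ^ k) M) × Fin (d + 1) => blockOf (L ^ r * L ^ k) M b'.1))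
      (idef (pull (kingPrV L k r M)) (pull (kingPrV L k r M)) (gOp M (L ^ r * L ^ k) a) (gOp M (L ^ k) a)) (fun y y' => C₀ * Real.exp (-(δ₀ * tdistT M y y'))))
    (h1 : ∀ ν, HasMaj (BlockNorm.ofBlocks (unitTorusGeo L k M) (fun b : Tor (fine (L ^ k) M) × Fin (d + 1) => blockOf (L ^ k) M b.1))
      (BlockNorm.ofBlocks (unitTorusGeo L k M) (fun b : Tor (fine (L ^ k) M) × Fin (d + 1) => blockOf (L ^ k) M b.1))
      (symbOp M (L ^ k) (sD M (L ^ k) ν ((L ^ k : ℕ) : ℝ)) ∘ₗ gOp M (L ^ k) a) (fun y y' => CD * Real.exp (-(δ₀ * tdistT M y y'))))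
    (hNL : HasMaj (BlockNorm.ofBlocks (unitTorusGeo L k M) (fun b : Tor (fine (L ^ k) M) × Fin (d + 1) => blockOf (L ^ k) M b.1))
      (BlockNorm.ofBlocks (unitTorusGeo L k M) (fun b : Tor (fine (L ^ k) M) × Fin (d + 1) => blockOf (L ^ k) M b.1)) (landauRe M (L ^ k))
      (fun y y' => C₁ * Real.exp (-(δ₁ * tdistT M y y'))))
    (hNL' : HasMaj (BlockNorm.ofBlocks (unitTorusGeo L k M) (fun b : Tor (fine (L ^ r * L ^ k) M) × Fin (d + 1) => blockOf (L ^ r * L ^ k) M b.1))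
      (BlockNorm.ofBlocks (unitTorusGeo L k M) (fun b : Tor (fine (L ^ r * L ^ k) M) × Fin (d + 1) => blockOf (L ^ r * L ^ k) M b.1)) (landauRe M (L ^ r * L ^ k))
      (fun y y' => C₁ * Real.exp (-(δ₁ * tdistT M y y'))))
    (hDN : HasMaj (BlockNorm.ofBlocks (unitTorusGeo L k M) (fun b : Tor (fine (L ^ k) M) × Fin (d + 1) => blockOf (L ^ k) M b.1))
      (BlockNorm.ofBlocks (unitTorusGeo L k M) (fun b : Tor (fine (L ^ r * L ^ k) M) × Fin (d + 1) => blockOf (L ^ r * L ^ k) M b.1))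
      (idef (pull (kingPrV L k r M)) (pull (kingPrV L k r M)) (a • (qvAdjRe M (L ^ r * L ^ k) ∘ₗ qvRe M (L ^ r * L ^ k)) + (-landauRe M (L ^ r * L ^ k)))
        (a • (qvAdjRe M (L ^ k) ∘ₗ qvRe M (L ^ k)) + (-landauRe M (L ^ k)))) (fun y y' => rN * Real.exp (-(δN * tdistT M y y'))))
    {h : Tor (fine (L ^ k) M) × Fin (d + 1) → ℝ} {h' χt' : Tor (fine (L ^ r * L ^ k) M) × Fin (d + 1) → ℝ} {χt : Tor (fine (L ^ k) M) × Fin (d + 1) → ℝ} {H : Set (Tor M)}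
    (hh1 : ∀ x, |h x| ≤ 1) (hhH : ∀ x, blockOf (L ^ k) M x.1 ∉ H → h x = 0) (hhH' : ∀ x', blockOf (L ^ r * L ^ k) M x'.1 ∉ H → h' x' = 0)
    (hfh : ∀ x', |h' x' - h (kingPrV L k r M x')| ≤ oh) (hχt1' : ∀ x', |χt' x'| ≤ 1) (hfχ : ∀ x', |χt' x' - χt (kingPrV L k r M x')| ≤ oχ)
    (hgap : ∀ y y', y ∉ cubeBlocks M c S → y' ∈ H → gap ≤ tdistT M y y') :
    HasMaj (BlockNorm.ofBlocks (unitTorusGeo L k M) (fun b : Tor (fine (L ^ k) M) × Fin (d + 1) => blockOf (L ^ k) M b.1))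
      (BlockNorm.ofBlocks (unitTorusGeo L k M) (fun b' : Tor (fine (L ^ r * L ^ k) M) × Fin (d + 1) => blockOf (L ^ r * L ^ k) M b'.1))
      (idef (pull (kingPrV L k r M)) (pull (kingPrV L k r M))
        (mulOp χt' ∘ₗ (mulOp (chiCube M (L ^ r * L ^ k) c S) ∘ₗ symOp M (L ^ r * L ^ k) c ∘ₗ (gOp M (L ^ r * L ^ k) a ∘ₗ (mulOp (1 - chiCube M (L ^ r * L ^ k) c S) ∘ₗ
          (a • (qvAdjRe M (L ^ r * L ^ k) ∘ₗ qvRe M (L ^ r * L ^ k)) + (-landauRe M (L ^ r * L ^ k))) ∘ₗ mulOp h')) ∘ₗ mulOp (chiCube M (L ^ r * L ^ k) c S)))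
        (mulOp χt ∘ₗ (mulOp (chiCube M (L ^ k) c S) ∘ₗ symOp M (L ^ k) c ∘ₗ (gOp M (L ^ k) a ∘ₗ (mulOp (1 - chiCube M (L ^ k) c S) ∘ₗ
          (a • (qvAdjRe M (L ^ k) ∘ₗ qvRe M (L ^ k)) + (-landauRe M (L ^ k))) ∘ₗ mulOp h)) ∘ₗ mulOp (chiCube M (L ^ k) c S))))
      (fun y y' => ind (cubeBlocks M c S : Set (Tor M)) y * ind (cubeBlocks M c S : Set (Tor M)) y' *
        ((2 ^ (d + 1) * Real.exp ρ *
            ((1 * C * (((|a| * (Real.exp δN * Real.exp δN) + C₁) * oh + rN + 0 * (|a| * (Real.exp δN * Real.exp δN) + C₁)) * Real.exp (-((δN - ρ₁) * gap))) * cr +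
                1 * C₀ * ((|a| * (Real.exp δN * Real.exp δN) + C₁) * Real.exp (-((δN - ρ₁) * gap))) * cr) +
              (d + 1) * (1 * (|(((L ^ k : ℕ) : ℝ))⁻¹| * CD) * ((|a| * (Real.exp δN * Real.exp δN) + C₁) * Real.exp (-((δN - ρ₁) * gap))) * cr)) +
          oχ * (2 ^ (d + 1) * ((1 : ℝ) * C * ((|a| * (Real.exp δN * Real.exp δN) + C₁) * Real.exp (-((δN - ρ₁) * gap))) * cr * Real.exp ρ))) *
        Real.exp (-(ρ * tdistT M y y')))) := by
  have hcr : 0 ≤ cr := hrow.nonneg c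
  have hd : ∀ y y' : Tor M, 0 ≤ tdistT M y y' := fun y y' => tdistT_nonneg M y y'
  have ha₁ : 0 ≤ (|a| * (Real.exp δN * Real.exp δN) + C₁) * Real.exp (-((δN - ρ₁) * gap)) := by positivity
  have hdP : 0 ≤ ((|a| * (Real.exp δN * Real.exp δN) + C₁) * oh + rN + 0 * (|a| * (Real.exp δN * Real.exp δN) + C₁)) * Real.exp (-((δN - ρ₁) * gap)) := by positivity
  have hκ : (BlockNorm.ofBlocks (unitTorusGeo L k M) (fun b : Tor (fine (L ^ k) M) × Fin (d + 1) => blockOf (L ^ k) M b.1)).κ = 1 := rfl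
  have hκ' : (BlockNorm.ofBlocks (unitTorusGeo L k M) (fun b : Tor (fine (L ^ r * L ^ k) M) × Fin (d + 1) => blockOf (L ^ r * L ^ k) M b.1)).κ = 1 := rfl
  -- the far factors at both grids and their defect
  have hP := hasMaj_adjFar (L := L) (k := k) (c := c) (S := S) (a := a) hC₁ hδN hδN₁ hρ₁ hNL hh1 hhH hgap
  have hDP := hasMaj_idef_adjFar (L := L) (k := k) (r := r) (c := c) (S := S) (a := a) hC₁ hδN hδN₁ hρ₁ hrN hoh hNL hNL' hDN hh1 hhH hhH' hfh hgap
  -- `X = G∘far`: coarse row, defect, one-step differences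
  have hX := hasMaj_comp_exp (b₁ := BlockNorm.ofBlocks (unitTorusGeo L k M) (fun b : Tor (fine (L ^ k) M) × Fin (d + 1) => blockOf (L ^ k) M b.1)) htri hd hrow hC ha₁ hρ hρρ₁ hρσ hG hP
  rw [hκ] at hX
  have hDX : HasMaj (BlockNorm.ofBlocks (unitTorusGeo L k M) (fun b : Tor (fine (L ^ k) M) × Fin (d + 1) => blockOf (L ^ k) M b.1))
      (BlockNorm.ofBlocks (unitTorusGeo L k M) (fun b' : Tor (fine (L ^ r * L ^ k) M) × Fin (d + 1) => blockOf (L ^ r * L ^ k) M b'.1))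
      (idef (pull (kingPrV L k r M)) (pull (kingPrV L k r M))
        (gOp M (L ^ r * L ^ k) a ∘ₗ (mulOp (1 - chiCube M (L ^ r * L ^ k) c S) ∘ₗ (a • (qvAdjRe M (L ^ r * L ^ k) ∘ₗ qvRe M (L ^ r * L ^ k)) + (-landauRe M (L ^ r * L ^ k))) ∘ₗ mulOp h'))
        (gOp M (L ^ k) a ∘ₗ (mulOp (1 - chiCube M (L ^ k) c S) ∘ₗ (a • (qvAdjRe M (L ^ k) ∘ₗ qvRe M (L ^ k)) + (-landauRe M (L ^ k))) ∘ₗ mulOp h)))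
      (fun y y' => (1 * C * (((|a| * (Real.exp δN * Real.exp δN) + C₁) * oh + rN + 0 * (|a| * (Real.exp δN * Real.exp δN) + C₁)) * Real.exp (-((δN - ρ₁) * gap))) * cr +
          1 * C₀ * ((|a| * (Real.exp δN * Real.exp δN) + C₁) * Real.exp (-((δN - ρ₁) * gap))) * cr) * Real.exp (-(ρ * tdistT M y y'))) := by
    rw [idef_comp (pull (kingPrV L k r M)) (pull (kingPrV L k r M)) (pull (kingPrV L k r M))]
    have t1 := hasMaj_comp_exp (b₁ := BlockNorm.ofBlocks (unitTorusGeo L k M) (fun b : Tor (fine (L ^ k) M) × Fin (d + 1) => blockOf (L ^ k) M b.1)) htri hd hrow hC hdP hρ hρρ₁ hρσ hG' hDP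
    have t2 := hasMaj_comp_exp (b₁ := BlockNorm.ofBlocks (unitTorusGeo L k M) (fun b : Tor (fine (L ^ k) M) × Fin (d + 1) => blockOf (L ^ k) M b.1)) htri hd hrow hC₀ ha₁ hρ hρρ₁ hρσ h0 hP
    rw [hκ'] at t1
    rw [hκ] at t2
    exact (t1.add t2).mono fun y y' => le_of_eq (by ring)
  have hn0 : (((L ^ k : ℕ) : ℝ)) ≠ 0 := by exact_mod_cast NeZero.ne (L ^ k)
  have hsteps : ∀ ν, HasMaj (BlockNorm.ofBlocks (unitTorusGeo L k M) (fun b : Tor (fine (L ^ k) M) × Fin (d + 1) => blockOf (L ^ k) M b.1))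
      (BlockNorm.ofBlocks (unitTorusGeo L k M) (fun b : Tor (fine (L ^ k) M) × Fin (d + 1) => blockOf (L ^ k) M b.1))
      (symbOp M (L ^ k) (sT M (L ^ k) ν - 1) ∘ₗ (gOp M (L ^ k) a ∘ₗ (mulOp (1 - chiCube M (L ^ k) c S) ∘ₗ (a • (qvAdjRe M (L ^ k) ∘ₗ qvRe M (L ^ k)) + (-landauRe M (L ^ k))) ∘ₗ mulOp h)))
      (fun y y' => 1 * (|(((L ^ k : ℕ) : ℝ))⁻¹| * CD) * ((|a| * (Real.exp δN * Real.exp δN) + C₁) * Real.exp (-((δN - ρ₁) * gap))) * cr * Real.exp (-(ρ * tdistT M y y'))) := by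
    intro ν
    have hsD : sT M (L ^ k) ν - 1 = (((L ^ k : ℕ) : ℝ))⁻¹ • sD M (L ^ k) ν ((L ^ k : ℕ) : ℝ) := by rw [← sD_one, sD, sD, smul_smul, inv_mul_cancel₀ hn0]
    have hGs : HasMaj (BlockNorm.ofBlocks (unitTorusGeo L k M) (fun b : Tor (fine (L ^ k) M) × Fin (d + 1) => blockOf (L ^ k) M b.1))
        (BlockNorm.ofBlocks (unitTorusGeo L k M) (fun b : Tor (fine (L ^ k) M) × Fin (d + 1) => blockOf (L ^ k) M b.1))
        (symbOp M (L ^ k) (sT M (L ^ k) ν - 1) ∘ₗ gOp M (L ^ k) a) (fun y y' => (|(((L ^ k : ℕ) : ℝ))⁻¹| * CD) * Real.exp (-(δ₀ * tdistT M y y'))) := by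
      rw [hsD, map_smul, LinearMap.smul_comp]
      exact (hasMaj_smul_ofBlocks _ (fun y y' => mul_nonneg hCD (Real.exp_nonneg _)) _ (h1 ν)).mono fun y y' => le_of_eq (by ring)
    have t := hasMaj_comp_exp (b₁ := BlockNorm.ofBlocks (unitTorusGeo L k M) (fun b : Tor (fine (L ^ k) M) × Fin (d + 1) => blockOf (L ^ k) M b.1)) htri hd hrow (by positivity) ha₁ hρ hρρ₁ hρσ hGs hP
    rw [hκ] at t
    rw [← LinearMap.comp_assoc]
    exact t
  -- the images-dressed sandwich (N-IIk′), then the fine bump in front with its fit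
  have hC₀X : 0 ≤ 1 * C * (((|a| * (Real.exp δN * Real.exp δN) + C₁) * oh + rN + 0 * (|a| * (Real.exp δN * Real.exp δN) + C₁)) * Real.exp (-((δN - ρ₁) * gap))) * cr +
      1 * C₀ * ((|a| * (Real.exp δN * Real.exp δN) + C₁) * Real.exp (-((δN - ρ₁) * gap))) * cr := by positivity
  have hC₁X : 0 ≤ 1 * (|(((L ^ k : ℕ) : ℝ))⁻¹| * CD) * ((|a| * (Real.exp δN * Real.exp δN) + C₁) * Real.exp (-((δN - ρ₁) * gap))) * cr := by positivity
  have hS := hasMaj_idef_chiCube_symOp_sandwich_of (L := L) (k := k) (r := r) (c := c) (S := S) hM hC₀X hC₁X hρ hDX hsteps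
  -- the coarse tail's two-sided row (§2 at the coarse spacing)
  have hXc := hasMaj_comp_mulOp_chiCube (c := c) (S := S) (fun y y' => by positivity) hX
  have hY := hasMaj_chiCube_symOp_comp (by positivity) hρ hM hXc
  rw [idef_comp (pull (kingPrV L k r M)) (pull (kingPrV L k r M)) (pull (kingPrV L k r M)) (mulOp χt'), idef_mulOp_eq]
  have hblk : ∀ x' : Tor (fine (L ^ r * L ^ k) M) × Fin (d + 1), blockOf (L ^ k) M (kingPrV L k r M x').1 = blockOf (L ^ r * L ^ k) M x'.1 := fun x' =>
    congrFun (blkFine_comp_kingPrV M L k r) x'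
  have t1 := hasMaj_mulOp_comp_of_abs_le_one _ hχt1' (fun y y' => mul_nonneg (mul_nonneg (ind_nonneg _ _) (ind_nonneg _ _)) (by positivity)) hS
  have hPY := hasMaj_pull_comp₂ (g := unitTorusGeo L k M) (fun b : Tor (fine (L ^ k) M) × Fin (d + 1) => blockOf (L ^ k) M b.1)
    (fun b : Tor (fine (L ^ r * L ^ k) M) × Fin (d + 1) => blockOf (L ^ r * L ^ k) M b.1) (kingPrV L k r M)
    (K' := fun y y' => ind (cubeBlocks M c S : Set (Tor M)) y * ind (cubeBlocks M c S : Set (Tor M)) y' *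
      (2 ^ (d + 1) * ((1 : ℝ) * C * ((|a| * (Real.exp δN * Real.exp δN) + C₁) * Real.exp (-((δN - ρ₁) * gap))) * cr * Real.exp ρ) * Real.exp (-(ρ * tdistT M y y'))))
    (fun y y' => mul_nonneg (mul_nonneg (ind_nonneg _ _) (ind_nonneg _ _)) (by positivity)) (fun x y' => by rw [hblk x]) hY
  have hMf := hasMaj_mulOp (g := unitTorusGeo L k M) (fun b : Tor (fine (L ^ r * L ^ k) M) × Fin (d + 1) => blockOf (L ^ r * L ^ k) M b.1) (a := χt' - χt ∘ kingPrV L k r M)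
    (m := fun _ => oχ) (fun _ => hoχ) fun x' => by rw [Pi.sub_apply, Function.comp_apply]; exact hfχ x'
  have t2 := hasMaj_diag_comp (g := unitTorusGeo L k M) (fun b : Tor (fine (L ^ r * L ^ k) M) × Fin (d + 1) => blockOf (L ^ r * L ^ k) M b.1) (fun _ => hoχ) hMf hPY
  refine (t1.add (t2.congr fun f => ?_)).mono fun y y' => le_of_eq ?_
  · simp only [LinearMap.comp_apply]
  · ring

end Defect

end Summit.QuantumFields.YangMills.BalabanUVNodes.N15.TwoGrid

end
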